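import Literature.AnabelianGeometry.AbsoluteAnabelian.AbsTopIThm26vFullSigmaProofs
import Literature.AnabelianGeometry.AbsoluteAnabelian.AbsTopIThm26SplitModelInstances
import Literature.AnabelianGeometry.AbsoluteAnabelian.FundamentalExtensionProSigmaGeomModel
import HarnessLib

/-!
# [AbsTopI] Thm 2.6 (v), general form (`Θ ⊆ Π`): instance forms with a NON-DEGENERATE `Δ`

S. Mochizuki, *Topics in Absolute Anabelian Geometry I: Generalities* (2012) [AbsTopI], Thm 2.6 (v),
manuscript p. 22 (lit key `paper:url-11ac98ba15fc`): "`ζ̃(Π) := ζ(Π/Θ) = [k : ℚ_p]` [...] the kernel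
of the quotient `Π ↠ G` may be characterized [...] as the intersection of the open subgroups `H ⊆ Π`
such that `ζ̃(H)/ζ̃(Π) = [Π : H]`" — typed `FundamentalExtension.Thm26vFull`.

PROOF-ONLY sequel (no definitions, no named facts) of this seat's `AbsTopIThm26vFullSigmaProofs.lean`
(`MLFBase.thm26vFull_of_exists_prime_not_mem`: for `Σ` missing a prime, `E.Thm26vFull B` from `Δ` tfg,
`Δ` pro-`Σ` and `Π` tfg), in the style of abc-iut's `AbsTopIThm26SplitModelInstances.lean` ((i), (ii),
(iv) at models):

* `MLFBase.thm26vFull_of_isProSigmaCompletion` — the MODEL CLASS of print: for every extension with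
  MLF base data whose `Δ` is presented as a pro-`Σ` completion `ι : Γ → Δ` of a finitely generated
  group (`Γ = Γ_{g,r}` for a hyperbolic orbicurve), `Σ ⊆ Primes` missing a prime, GIVEN "`G_k`
  topologically finitely generated" ([NSW] Thm 7.5.10; a theorem of the tree Summits-side,
  `isTopologicallyFinitelyGenerated_gal_of_mlfBase`), the general-`Θ` Thm 2.6 (v) HOLDS — with no
  hypothesis on the outer Galois action;
* `thm26vFull_split_of_isProSigmaCompletion` — at the SPLIT model `Π := Δ̂ × G_K ↠ G_K`;
* `exists_mlfBase_geom_ne_bot_thm26vFull` — NON-VACUITY with `Δ ≠ 1` and `Θ = Δ ≠ {1}`: for every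
  prime `p`, every `Σ ⊆ Primes` containing a prime and missing a prime, an MLF-based extension with
  `Δ` slim, elastic, tfg, pro-`Σ` (a pro-`Σ` completion of `Γ_{0,3} ≅ F₂`) satisfying `Thm26vFull`
  exists (given `G_{ℚ_p}` tfg).

HONEST FRAMING: model-level satisfiability of the typed predicate, not the extension of a curve (the
split model has trivial outer action); refereed, undisputed statement; abc-iut cell, block C seat
abc-iut-w6-d034; nothing here bears on [IUTchIII] Cor. 3.12.
-/

noncomputable section

open Topology Field

namespace Literature.AnabelianGeometry.AbsoluteAnabelian

open Literature.AnabelianGeometry.SemiGraphs.SemiGraphOfAnabelioids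
open Literature.GroupTheory.CombinatorialGroupTheory

universe u

namespace FundamentalExtension

/-- **[AbsTopI] Thm 2.6 (v), GENERAL form, on the model class of print** — for every extension
`1 → Δ → Π → G → 1` with MLF base data `G ≅ G_k` whose `Δ` is presented as a pro-`Σ` completion
`ι : Γ → Δ` of a finitely generated group `Γ`, with `Σ ⊆ Primes` missing at least one prime, GIVEN
"`G_k` is topologically finitely generated" ([NSW] Thm 7.5.10, print's input for "`Π` tfg", proof
p. 23): the typed `E.Thm26vFull B` holds (`ζ̃(Π) = ζ(Π/Θ) = [k : ℚ_p]`, here with `Θ = Δ`, and the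
`ζ̃`-characterisation of `Δ`).  Prop 2.2 and "`Δ` pro-`Σ`" are discharged at the model
(`geomTFG_of_isProSigmaCompletion`, `isProSet_of_isProSigmaCompletion`); the rest is this seat's
`MLFBase.thm26vFull_of_exists_prime_not_mem`. [cite: MochizukiAbsTopI2012, Thm 2.6 (v) p.22] -/
theorem MLFBase.thm26vFull_of_isProSigmaCompletion {E : FundamentalExtension.{0}} (B : E.MLFBase)
    {Γ : Type u} [Group Γ] [Group.FG Γ] {S : Set ℕ} {ι : Γ →* E.geom}
    (hι : IsProSigmaCompletion S ι) (hS : S ⊆ {q | q.Prime}) (hq : ∃ q : ℕ, q.Prime ∧ q ∉ S)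
    (hG : IsTopologicallyFinitelyGenerated E.gal) : E.Thm26vFull B :=
  MLFBase.thm26vFull_of_exists_prime_not_mem B hS hq (E.geomTFG_of_isProSigmaCompletion ι hι)
    (IsTopologicallyFinitelyGenerated.of_extension E.aug E.aug_surjective
      (E.geomTFG_of_isProSigmaCompletion ι hι) hG)
    (isProSet_of_isProSigmaCompletion hι)

/-! ### The split model `Π := Δ̂ × G_K ↠ G_K` -/

section Split

variable (P : ProfiniteGrp.{0}) (K : Type) [Field K] [CharZero K]

/-- **[AbsTopI] Thm 2.6 (v), general form, at the split model** `Π := Δ̂ × G_K ↠ G_K`, `Δ̂` a pro-`Σ`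
completion of a finitely generated group, `Σ ⊆ Primes` missing a prime, MLF base datum `(p, K, refl)`,
GIVEN `G_K` topologically finitely generated.  HONEST LABEL: a split model (trivial outer action), a
satisfiability witness of the typed predicate with non-degenerate `Δ`, not a curve's extension.
[cite: MochizukiAbsTopI2012, Thm 2.6 (v) p.22] -/
theorem thm26vFull_split_of_isProSigmaCompletion {Γ : Type u} [Group Γ] [Group.FG Γ] {S : Set ℕ}
    {ι : Γ →* P} (hι : IsProSigmaCompletion S ι) (hS : S ⊆ {q | q.Prime})
    (hq : ∃ q : ℕ, q.Prime ∧ q ∉ S)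
    (p : ℕ) [Fact p.Prime] [Algebra ℚ_[p] K] [FiniteDimensional ℚ_[p] K]
    (hG : IsTopologicallyFinitelyGenerated (absoluteGaloisGroup K)) :
    Literature.AnabelianGeometry.AbsoluteAnabelian.FundamentalExtension.Thm26vFull
      ⟨ProfiniteGrp.of (P × absoluteGaloisGroup K), absoluteGaloisGrp K,
        ContinuousMonoidHom.snd P (absoluteGaloisGroup K), Prod.snd_surjective⟩
      { p := p, K := K, galIso := ContinuousMulEquiv.refl _ } := by
  obtain ⟨j, hj⟩ := exists_surjective_toGeom_split P K
  have hP : IsTopologicallyFinitelyGenerated P :=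
    IsProSigmaCompletion.isTopologicallyFinitelyGenerated_of_fg hι
  refine MLFBase.thm26vFull_of_exists_prime_not_mem _ hS hq (hP.of_surjective j hj) ?_
    ((isProSet_of_isProSigmaCompletion hι).of_surjective j hj)
  exact IsTopologicallyFinitelyGenerated.of_extension
    (ContinuousMonoidHom.snd P (absoluteGaloisGroup K)) Prod.snd_surjective (hP.of_surjective j hj) hG

end Split

/-! ### Non-vacuity with `Δ ≠ 1` (so `Θ = Δ ≠ {1}`) -/

/-- **Non-vacuity of the general-`Θ` Thm 2.6 (v) with a non-degenerate `Δ`.**  For every prime `p`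
and every `Σ ⊆ Primes` that contains a prime and misses a prime, GIVEN `G_{ℚ_p}` topologically
finitely generated ([NSW] Thm 7.5.10; Summits-side theorem of the tree): there is an extension with
MLF base data (`G = G_{ℚ_p}`) whose `Δ` is topologically finitely generated, slim and elastic (hence
`≠ 1`) and pro-`Σ` — a pro-`Σ` completion of `Γ_{0,3}` (the thrice-punctured line's `F₂`), product
model of `FundamentalExtensionProSigmaGeomModel.lean` — which satisfies the typed `Thm26vFull`.  The
input `hG` is the `∀ K/ℚ_p finite` form of [NSW] 7.5.10 (abc-iut GAP G-L4t4-2, PROVED Summits-side as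
`isTopologicallyFinitelyGenerated_absoluteGaloisGroup_padic`).  In
it `Θ = Δ` (the unique maximal almost pro-omissive tfg closed normal subgroup), so this inhabits the
`Θ ≠ {1}` branch of the definition. [cite: MochizukiAbsTopI2012, Thm 2.6 (v) p.22] -/
theorem exists_mlfBase_geom_ne_bot_thm26vFull (p : ℕ) [Fact p.Prime] {S : Set ℕ}
    (hS : S ⊆ {q | q.Prime}) (hS' : ∃ ℓ ∈ S, ℓ.Prime) (hq : ∃ q : ℕ, q.Prime ∧ q ∉ S)
    (hG : ∀ (p : ℕ) [Fact p.Prime] (K : Type) [Field K] [Algebra ℚ_[p] K] [FiniteDimensional ℚ_[p] K],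
      IsTopologicallyFinitelyGenerated (absoluteGaloisGroup K)) :
    ∃ (E : FundamentalExtension.{0}) (B : E.MLFBase),
      E.GeomTFG ∧ E.GeomSlimElastic ∧ IsProSet E.geom S ∧ E.Thm26vFull B := by
  obtain ⟨E, B, ι, hι⟩ := exists_mlfBase_proSigma_model p 0 3 S
  have h3 : PuncturedSurfaceGroup.IsHyperbolicType 0 3 := by
    unfold PuncturedSurfaceGroup.IsHyperbolicType; norm_num
  obtain ⟨h1, h2, h4⟩ := geom_props_of_isProSigmaCompletion_puncturedSurfaceGroup (by norm_num) h3 hι hS'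
  letI := B.instPrime; letI := B.instField; letI := B.instAlgebra; letI := B.instFinite
  have hGal : IsTopologicallyFinitelyGenerated E.gal :=
    (hG B.p B.K).of_continuousMulEquiv B.galIso.symm
  exact ⟨E, B, h1, h2, h4, MLFBase.thm26vFull_of_exists_prime_not_mem B hS hq h1
    (IsTopologicallyFinitelyGenerated.of_extension E.aug E.aug_surjective h1 hGal) h4⟩

end FundamentalExtension

end Literature.AnabelianGeometry.AbsoluteAnabelian

end
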